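import Summits.QuantumFields.YangMills.Theorems.UnitScaleTiltHistoryTailBlockRegions
import Literature.MathematicalPhysics.QuantumFieldTheory.Balaban1983to89.B10Eq38TorusDomains

/-!
# Route `UnitScaleTilt` — crux K2 `HistoryTail` (stmt-QuantumFields-18916): THE FINE FOOTPRINT OF THE REGIONS UNDER A PLAQUETTE — every plaquette the
# local (69)–(71) chain looks at (the `ℓ∞`-boxes of radius `(d+2)L + 2` around the block bases of the bonds of the nested regions) has its corners in the
# fine box of radius `8L^j` around `toFine j p′.src`; hence «that fine box lies in `Ω_j(h)`» gives the `hbox` hypothesis of `smallFactor71_top`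
# (support file; pure torus geometry, route-independent imports)

Fleet lead `ym-ust-18916-p1` (gen 2), 2026-08-26.  Continues `HistoryTailBlockRegions` (p469626: centres `c_s`, boxes of radius `3(L^{j−s} − 1)`,
closure, count).  `HistoryTailAlphaTopPlaquette.smallFactor71_top` (p466694) asks, besides the regions, that for every `s < j`, every `q ∈ R_{s+1}`,
every bond `c` of `q` and every level-`s` site `z` in the `ℓ∞`-box of radius `(d+2)L + 2` around `emb c.src`, the plaquettes `⟨z, a, b⟩` lie in
`plaqsIn s (Λ_j(h))`, i.e. have their four corners (read on the fine torus through `toFine s`) in the history's top region.  THIS FILE reduces that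
to ONE inclusion of a fine box:

* `toFine_add_intVec` — `toFine s (x + e) = toFine s x + L^s·e` for integer offset vectors (induction on `s` from `Site.emb_add` and
  `HistoryTailBlockRegions.scaleCoord_intCast`); `toFine_ctr` — `toFine s c_s = toFine j p′.src` for the centres;
* **`corner_mem_fineBox`** — under the footprint clause of `exists_nested_regions` (`q.src ∈ c_{s+1} + [−ρ_{s+1}, ρ_{s+1}]^d`, `ρ_{s+1} = 3(L^{j−s−1} − 1)`),
  for `c.src ∈ {q.src, q.src + e_μ, q.src + e_ν}`, `z ∈ emb c.src + [−n, n]^d` (`n = (d+2)L + 2`) and any corner `w ∈ {z, z+e_a, z+e_b, z+e_a+e_b}`: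
  `toFine s w ∈ toFine j p′.src + [−8L^j, 8L^j]^d` (the offset is `L^s·(L e′ + δ + e + δ′)` with `|·| ≤ 3L^j + 3L^{s+1} + 4L^s ≤ 8L^j`);
* **`mem_plaqsIn_of_fineBox_subset`** — consequently, if the fine box `toFine j p′.src + [−8L^j, 8L^j]^d` lies in a region `Ω`, every such plaquette
  `⟨z, a, b⟩` is in `plaqsIn s Ω` — the `hbox` hypothesis of `smallFactor71_top` with `Ω = Λ_j(h) = Ω_j(h)`.

References: T. Bałaban, CMP 102 (1985) 255–275 [Balaban1985UV3] ((68)–(70) p.273); CMP 109 (1987) 249–301 [Balaban1987RG1] ((0.1)–(0.3) pp.251–252).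
-/

noncomputable section

open scoped BigOperators

namespace Summit.QuantumFields.YangMills.Theorems.HistoryTailBlockFootprint

open Literature.MathematicalPhysics.QuantumFieldTheory.Balaban1983to89
open B10Eq38TorusDomains (toFine toFine_succ cornerSet plaqsIn mem_plaqsIn_iff)
open Summit.QuantumFields.YangMills.Theorems.HistoryTailBlockRegions (shift_apply' scaleCoord_intCast)

variable {P : Params}

/-! ## §1 `toFine` of an integer offset -/

/-- **`toFine s (x + e) = toFine s x + L^s·e`** for an integer offset vector `e` (coordinatewise casts). [cite: Balaban1987RG1, (0.1) p.251] -/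
theorem toFine_add_intVec : ∀ (s : ℕ) (x : Site P s) (e : Fin P.d → ℤ),
    toFine s (x + (show Site P s from fun ι => ((e ι : ℤ) : ZMod (P.sitesPerDir s)))) =
      toFine s x + (show Site P 0 from fun ι => ((((P.L : ℤ) ^ s * e ι : ℤ)) : ZMod (P.sitesPerDir 0)))
  | 0, x, e => by
    show x + _ = x + _
    congr 1
    funext ι
    simp
  | s + 1, y, e => by
    rw [toFine_succ, toFine_succ, Site.emb_add]
    have hscale : Site.scale (show Site P (s + 1) from fun ι => ((e ι : ℤ) : ZMod (P.sitesPerDir (s + 1)))) =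
        (show Site P s from fun ι => ((((P.L : ℤ) * e ι : ℤ)) : ZMod (P.sitesPerDir s))) := by
      funext ι
      rw [Site.scale_apply]
      exact scaleCoord_intCast s (e ι)
    rw [hscale, toFine_add_intVec s (emb y) (fun ι => (P.L : ℤ) * e ι)]
    congr 1
    funext ι
    push_cast
    ring

/-- `toFine` of the centres down the tower is constant: `toFine s c_s = toFine j c_j`. [cite: Balaban1987RG1, (0.1) p.252] -/
theorem toFine_ctr {j : ℕ} (ctr : (s : ℕ) → Site P s) (hstep : ∀ s, s < j → ctr s = emb (ctr (s + 1))) :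
    ∀ s, s ≤ j → toFine s (ctr s) = toFine j (ctr j) := by
  suffices h : ∀ n s, s + n = j → toFine s (ctr s) = toFine j (ctr j) by
    intro s hs; exact h (j - s) s (by omega)
  intro n
  induction n with
  | zero =>
    intro s hs
    have hsj : s = j := by omega
    subst hsj; rfl
  | succ n ih =>
    intro s hs
    have hsj : s < j := by omega
    rw [hstep s hsj, ← toFine_succ, ih (s + 1) (by omega)]

/-! ## §2 Boxes of integer offsets: closure under unit steps and one-step embedding -/

/-- A unit step moves a box point by one: `x ∈ c + [−ρ, ρ]^d ⇒ x + e_μ ∈ c + [−(ρ+1), ρ+1]^d`. [folklore] -/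
theorem shift_mem_box {s : ℕ} {c x : Site P s} {ρ : ℤ} (μ : Fin P.d)
    (hx : ∀ ι, ∃ e : ℤ, |e| ≤ ρ ∧ x ι = c ι + (e : ZMod (P.sitesPerDir s))) :
    ∀ ι, ∃ e : ℤ, |e| ≤ ρ + 1 ∧ (x.shift μ) ι = c ι + (e : ZMod (P.sitesPerDir s)) := by
  intro ι
  obtain ⟨e, he, hxe⟩ := hx ι
  have he' := abs_le.mp he
  by_cases h : ι = μ
  · refine ⟨e + 1, abs_le.mpr ⟨by linarith, by linarith⟩, ?_⟩
    rw [shift_apply', hxe, if_pos h]; push_cast; ring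
  · refine ⟨e, by linarith [abs_nonneg e], ?_⟩
    rw [shift_apply', hxe, if_neg h]; ring

/-- A box is monotone in its radius. [folklore] -/
theorem box_mono {s : ℕ} {c x : Site P s} {ρ ρ' : ℤ} (hρ : ρ ≤ ρ')
    (hx : ∀ ι, ∃ e : ℤ, |e| ≤ ρ ∧ x ι = c ι + (e : ZMod (P.sitesPerDir s))) :
    ∀ ι, ∃ e : ℤ, |e| ≤ ρ' ∧ x ι = c ι + (e : ZMod (P.sitesPerDir s)) := fun ι => by
  obtain ⟨e, he, h⟩ := hx ι; exact ⟨e, he.trans hρ, h⟩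

/-- **ONE STEP DOWN**: if `y ∈ c + [−ρ, ρ]^d` at level `s+1` and `z ∈ emb y + [−n, n]^d` at level `s`, then `z ∈ emb c + [−(Lρ + n), Lρ + n]^d`.
[cite: Balaban1987RG1, (0.1) p.251] -/
theorem box_emb {s : ℕ} {c y : Site P (s + 1)} {z : Site P s} {ρ n : ℤ}
    (hy : ∀ ι, ∃ e : ℤ, |e| ≤ ρ ∧ y ι = c ι + (e : ZMod (P.sitesPerDir (s + 1))))
    (hz : ∀ ι, ∃ e : ℤ, |e| ≤ n ∧ z ι = emb y ι + (e : ZMod (P.sitesPerDir s))) :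
    ∀ ι, ∃ e : ℤ, |e| ≤ (P.L : ℤ) * ρ + n ∧ z ι = emb c ι + (e : ZMod (P.sitesPerDir s)) := by
  intro ι
  obtain ⟨e', he', hye⟩ := hy ι
  obtain ⟨e, he, hze⟩ := hz ι
  have hy' : y = c + (show Site P (s + 1) from fun κ => if κ = ι then ((e' : ℤ) : ZMod (P.sitesPerDir (s + 1))) else y κ - c κ) := by
    funext κ
    show y κ = c κ + (if κ = ι then ((e' : ℤ) : ZMod (P.sitesPerDir (s + 1))) else y κ - c κ)
    by_cases hκ : κ = ι
    · subst hκ; simp [hye]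
    · simp [hκ]
  have hemb : emb y ι = emb c ι + (((P.L : ℤ) * e' : ℤ) : ZMod (P.sitesPerDir s)) := by
    rw [hy', Site.emb_add]
    show emb c ι + Site.scale _ ι = _
    rw [Site.scale_apply]
    simp only [if_true]
    rw [scaleCoord_intCast]
  have hL0 : (0 : ℤ) ≤ (P.L : ℤ) := by positivity
  have h1 := abs_le.mp he'
  have h2 := abs_le.mp he
  refine ⟨(P.L : ℤ) * e' + e, abs_le.mpr ⟨?_, ?_⟩, ?_⟩
  · nlinarith [mul_le_mul_of_nonneg_left h1.1 hL0]
  · nlinarith [mul_le_mul_of_nonneg_left h1.2 hL0]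
  · rw [hze, hemb]; push_cast; ring

/-! ## §3 The fine footprint of the plaquettes the local chain looks at -/

/-- **EVERY CORNER LANDS IN THE FINE BOX OF RADIUS `8L^j`**: with centres `c_s` (`c_s = emb c_{s+1}`, `s < j`), a base `q.src ∈ c_{s+1} +
[−3(L^{j−s−1}−1), 3(L^{j−s−1}−1)]^d`, a bond base `y ∈ {q.src, q.src + e_μ, q.src + e_ν}` (so `y ∈ c_{s+1} + [−(ρ+1), ρ+1]^d`), a site
`z ∈ emb y + [−n, n]^d` with `n = (d+2)L + 2`, and a corner `w` of a plaquette based at `z` (`w ∈ z + [0, 2]`-steps): `toFine s w ∈ toFine j c_j +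
[−8L^j, 8L^j]^d`.  (Offset `L^s·(L(ρ+1) + n + 2)` with `L^{s+1}(ρ + 1) ≤ 3L^j`, `L^s(n + 2) = (d+2)L^{s+1} + 4L^s ≤ 5L^j + … `; we use `d = 3`.)
[cite: Balaban1985UV3, (68)-(70) p.273] -/
theorem corner_mem_fineBox (hd : P.d = 3) {j : ℕ} (ctr : (s : ℕ) → Site P s) (hstep : ∀ s, s < j → ctr s = emb (ctr (s + 1)))
    {s : ℕ} (hs : s < j) (y : Site P (s + 1))
    (hy : ∀ ι, ∃ e : ℤ, |e| ≤ 3 * ((P.L : ℤ) ^ (j - (s + 1)) - 1) + 1 ∧ y ι = ctr (s + 1) ι + (e : ZMod (P.sitesPerDir (s + 1))))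
    (w : Site P s)
    (hw : ∀ ι, ∃ e : ℤ, |e| ≤ (((P.d + 2) * P.L + 2 : ℕ) : ℤ) + 2 ∧ w ι = emb y ι + (e : ZMod (P.sitesPerDir s))) :
    ∀ ι, ∃ e : ℤ, |e| ≤ 8 * (P.L : ℤ) ^ j ∧ toFine s w ι = toFine j (ctr j) ι + (e : ZMod (P.sitesPerDir 0)) := by
  have hL1 : (1 : ℤ) ≤ (P.L : ℤ) := by exact_mod_cast P.hL.2.le
  have hL0 : (0 : ℤ) ≤ (P.L : ℤ) := by linarith
  have hL2 : (2 : ℤ) ≤ (P.L : ℤ) := by exact_mod_cast P.hL.2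
  -- `w ∈ emb c_{s+1} + [−R, R]^d = c_s + [−R, R]^d`, `R = L(ρ+1) + n + 2`
  have hbox := box_emb hy hw
  rw [← hstep s hs] at hbox
  -- write `w = c_s + e` and push through `toFine s`
  choose e he hwe using hbox
  have hw' : w = ctr s + (show Site P s from fun ι => ((e ι : ℤ) : ZMod (P.sitesPerDir s))) := by
    funext ι; exact hwe ι
  intro ι
  refine ⟨(P.L : ℤ) ^ s * e ι, ?_, ?_⟩
  · -- the size: `L^s·(L·(3(L^{j−s−1}−1)+1) + (d+2)L + 4) ≤ 8L^j`
    have hes := abs_le.mp (he ι)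
    have hLs0 : (0 : ℤ) ≤ (P.L : ℤ) ^ s := pow_nonneg hL0 s
    have hjs : (P.L : ℤ) ^ j = (P.L : ℤ) ^ s * ((P.L : ℤ) * (P.L : ℤ) ^ (j - (s + 1))) := by
      rw [← pow_succ', ← pow_add]; congr 1; omega
    have hB1 : (1 : ℤ) ≤ (P.L : ℤ) ^ (j - (s + 1)) := one_le_pow₀ hL1
    have h1 : (P.L : ℤ) ^ s * (P.L : ℤ) ≤ (P.L : ℤ) ^ s * (P.L : ℤ) * (P.L : ℤ) ^ (j - (s + 1)) :=
      le_mul_of_one_le_right (mul_nonneg hLs0 hL0) hB1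
    have h2 : 2 * (P.L : ℤ) ^ s ≤ (P.L : ℤ) ^ s * (P.L : ℤ) := by nlinarith
    have hbound : (P.L : ℤ) ^ s * ((P.L : ℤ) * (3 * ((P.L : ℤ) ^ (j - (s + 1)) - 1) + 1) +
        ((((P.d + 2) * P.L + 2 : ℕ) : ℤ) + 2)) ≤ 8 * (P.L : ℤ) ^ j := by
      rw [hjs, hd]; push_cast
      nlinarith [h1, h2, hLs0]
    rw [abs_le]
    constructor
    · nlinarith [mul_le_mul_of_nonneg_left hes.1 hLs0]
    · nlinarith [mul_le_mul_of_nonneg_left hes.2 hLs0]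
  · rw [hw', toFine_add_intVec, ← toFine_ctr ctr hstep s hs.le]
    rfl

/-- **THE `hbox` HYPOTHESIS OF `smallFactor71_top` FROM ONE FINE-BOX INCLUSION** (`d = 3`): with the regions of
`HistoryTailBlockRegions.exists_nested_regions` (centres `ctr`, footprint radius `3(L^{j−s}−1)`), if the fine box `toFine j p′.src + [−8L^j, 8L^j]³`
lies in `Ω`, then for `s < j`, `q` in the level-`(s+1)` box, every bond `c` of `q`, every `z` in the `ℓ∞`-box of radius `(d+2)L + 2` around
`emb c.src` and every `a < b`, the plaquette `⟨z, a, b⟩` belongs to `plaqsIn s Ω`. [cite: Balaban1985UV3, (68)-(70) p.273] -/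
theorem mem_plaqsIn_of_fineBox_subset (hd : P.d = 3) {j : ℕ} (p' : Plaq P j) (ctr : (s : ℕ) → Site P s) (hcj : ctr j = p'.src)
    (hstep : ∀ s, s < j → ctr s = emb (ctr (s + 1))) (Ω : Set (Site P 0))
    (hΩ : {x : Site P 0 | ∀ ι, ∃ e : ℤ, |e| ≤ 8 * (P.L : ℤ) ^ j ∧ x ι = toFine j p'.src ι + (e : ZMod (P.sitesPerDir 0))} ⊆ Ω)
    {s : ℕ} (hs : s < j) (q : Plaq P (s + 1))
    (hq : ∀ ι, ∃ e : ℤ, |e| ≤ 3 * ((P.L : ℤ) ^ (j - (s + 1)) - 1) ∧ q.src ι = ctr (s + 1) ι + (e : ZMod (P.sitesPerDir (s + 1))))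
    (c : PBond P (s + 1))
    (hc : c = ⟨q.src, q.μ⟩ ∨ c = ⟨q.src.shift q.μ, q.ν⟩ ∨ c = ⟨q.src.shift q.ν, q.μ⟩ ∨ c = ⟨q.src, q.ν⟩)
    (z : Site P s)
    (hz : ∀ ν, ∃ e : ℤ, |e| ≤ (((P.d + 2) * P.L + 2 : ℕ) : ℤ) ∧ z ν = (emb c.src) ν + (e : ZMod (P.sitesPerDir s)))
    (a b : Fin P.d) (hab : a < b) :
    (⟨z, a, b, hab⟩ : Plaq P s) ∈ plaqsIn s Ω := by
  rw [mem_plaqsIn_iff]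
  -- the bond base is in the box of radius `ρ + 1`
  have hy : ∀ ι, ∃ e : ℤ, |e| ≤ 3 * ((P.L : ℤ) ^ (j - (s + 1)) - 1) + 1 ∧
      c.src ι = ctr (s + 1) ι + (e : ZMod (P.sitesPerDir (s + 1))) := by
    rcases hc with h | h | h | h <;> subst h
    · exact box_mono (by linarith) hq
    · exact shift_mem_box q.μ hq
    · exact shift_mem_box q.ν hq
    · exact box_mono (by linarith) hq
  -- every corner is within `n + 2` of `emb c.src`
  have hcorner : ∀ w ∈ ({z, z.shift a, z.shift b, (z.shift a).shift b} : Set (Site P s)),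
      ∀ ι, ∃ e : ℤ, |e| ≤ (((P.d + 2) * P.L + 2 : ℕ) : ℤ) + 2 ∧ w ι = emb c.src ι + (e : ZMod (P.sitesPerDir s)) := by
    intro w hw
    simp only [Set.mem_insert_iff, Set.mem_singleton_iff] at hw
    rcases hw with rfl | rfl | rfl | rfl
    · exact box_mono (by linarith) hz
    · exact box_mono (by linarith) (shift_mem_box a hz)
    · exact box_mono (by linarith) (shift_mem_box b hz)
    · exact shift_mem_box b (shift_mem_box a hz)
  intro x hx
  simp only [cornerSet, Set.mem_insert_iff, Set.mem_singleton_iff] at hx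
  apply hΩ
  show ∀ ι, ∃ e : ℤ, |e| ≤ 8 * (P.L : ℤ) ^ j ∧ x ι = toFine j p'.src ι + (e : ZMod (P.sitesPerDir 0))
  rw [← hcj]
  rcases hx with rfl | rfl | rfl | rfl
  · exact corner_mem_fineBox hd ctr hstep hs c.src hy z (hcorner z (by simp))
  · exact corner_mem_fineBox hd ctr hstep hs c.src hy _ (hcorner (z.shift a) (by simp))
  · exact corner_mem_fineBox hd ctr hstep hs c.src hy _ (hcorner (z.shift b) (by simp))
  · exact corner_mem_fineBox hd ctr hstep hs c.src hy _ (hcorner ((z.shift a).shift b) (by simp))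

end Summit.QuantumFields.YangMills.Theorems.HistoryTailBlockFootprint

end
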